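import Summits.BirchSwinnertonDyer.BirchSwinnertonDyer.Theorems.Rank1ResidualJetSwapLevelRaising
import Summits.BirchSwinnertonDyer.BirchSwinnertonDyer.Theorems.Rank1ResidualJetModPSwapStepKolyvagin
import HarnessLib

/-!
# T1 JET road K WITHOUT the `p`-adic tower — part 8: level raising at minimal depth (the swap walk)
# (width seat `bsd-wall-soed-p2-w2` g5; `--supports`, helper)

Series note (see `Rank1ResidualJetModPCebotarev`, part 1): the road-K end forms
`JET.jetchevDivisibilityCarrier{Ne,Mult,Add}_of_swapLiterature` (Jetchev 2008 Thm. 1.4 at a bad prime `p ∣ N`,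
cell `bsd-jet`) carry the `p`-adic tower binder although every leaf use in their cone is `htower 1`; at `p = 3`
the tower does not follow from `ρ̄₃` onto (Elkies 2006) and the SOED crux of record Ko′ (stmt-24696) is
tower-free. This file re-issues, decl by decl (suffix `_modP`, same namespace, proof text = the original with
`htower 1 ↦ hsurj`, McCallum's Cor. 3.2 / Prop. 4.4 fed by their mod-`p` derivations of parts 1–2), the
following decl(s) of `Rank1ResidualJetSwapLevelRaising` with `(hsurj : W.HasSurjectiveModNGaloisRep p)` in place of the
tower. Nothing of `bsd-jet`'s is edited. HONEST FRAMING: theorems only, CONDITIONAL on the displayed hypotheses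
(named print: Poitou–Tate for Selmer structures, [GZ86 III (3.1)], Gross 1991 Prop. 3.7 (2) where they occur);
no new definition, no named fact, no `sorry`; BSD is not proved by this file.
References: [cite: Jetchev2008, Thm. 1.4, Prop. 4.9, Lemma 5.1, Thm. 5.2, Prop. 5.3 (pp. 812–824)]
[cite: McCallumLMS1991, §3 Cor. 3.2, §4 Prop. 4.4, §5 Prop. 5.2] [cite: GrossLMS1991, Prop. 3.7 (2), §6]
[cite: Cha2005, Thm. 3, Thm. 7] [cite: Elkies2006, Introduction].
-/

set_option autoImplicit false

noncomputable section

open scoped Classical Pointwise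
open Function NumberField IsDedekindDomain WeierstrassCurve Field
open Literature.NumberTheory.EllipticCurves Literature.NumberTheory.GaloisRepresentations
open Literature.NumberTheory.EllipticCurves.Jetchev2008 Literature.NumberTheory.EllipticCurves.KolyvaginCocycle
open Literature.NumberTheory.EllipticCurves.ModularForms
open Literature.NumberTheory.GaloisCohomology Literature.NumberTheory.Automorphic
open Literature.NumberTheory.GaloisRepresentations.DiscreteGaloisModule (transverseSubgroup SelmerStructure)
open Summit.BirchSwinnertonDyer.Rank1Residual.JET.SelmerVocabulary
open Summit.BirchSwinnertonDyer.Rank1Residual.JET.GlobalDuality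
open Summit.BirchSwinnertonDyer.Rank1Residual.X11b
open Summit.BirchSwinnertonDyer.Rank1Residual.X11b.Three
open Summit.BirchSwinnertonDyer.BirchSwinnertonDyer.Theorems

namespace Summit.BirchSwinnertonDyer.Rank1Residual.JET.Swap

variable {K : Type} [Field K] [NumberField K] (W : WeierstrassCurve ℚ) [W.IsElliptic]
  [W.IsGloballyMinimal] [NeZero (W.conductorNorm ℤ)]
  (τ : K ≃ₐ[ℚ] K) (p : ℕ) [Fact p.Prime] [NeZero (p ^ 1)]
  [Finite (geomTorsion (W.baseChange K) ((p ^ 1 : ℕ) : ℤ))]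
  (e : geomTorsion (W.baseChange K) ((p ^ 1 : ℕ) : ℤ) → geomTorsion (W.baseChange K) ((p ^ 1 : ℕ) : ℤ) →
    AlgebraicClosure K)
  (hμ : ∀ S T, e S T ^ (p ^ 1) = 1)
  (hadd₁ : ∀ S₁ S₂ T, e (S₁ + S₂) T = e S₁ T * e S₂ T)
  (hadd₂ : ∀ S T₁ T₂, e S (T₁ + T₂) = e S T₁ * e S T₂)
  (hgal : ∀ (g : absoluteGaloisGroup K) (S T : geomTorsion (W.baseChange K) ((p ^ 1 : ℕ) : ℤ)),
    g • e S T = e (g • S) (g • T))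
  (halt : ∀ T, e T T = 1) (hnondeg : ∀ T, (∀ S, e S T = 1) → T = 0)
  (hτe : ∀ S T, liftAut τ (e S T) =
    e ((isLiftOfAut_liftAut τ).torsionMap W ((p ^ 1 : ℕ) : ℤ) S)
      ((isLiftOfAut_liftAut τ).torsionMap W ((p ^ 1 : ℕ) : ℤ) T))

include halt hnondeg hτe in
/-- (mod-`p` twin of `exists_conductor_levelIndex_ge_of_minDepth`: the `p`-adic tower binder replaced by `ρ̄_{E,p}` onto; proof text otherwise that of the original.) **LEVEL RAISING AT MINIMAL DEPTH** — McCallum 1991 Prop. 5.2 (`C = {0}`) in the form the §6 bridge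
consumes, PROVED modulo the named print {`h44`, the Poitou–Tate package, [GZ86 III (3.1)]} and the
walk's local inputs (all tree theorems at level `p^k`); see the module docstring.
[cite: McCallumLMS1991, §5 Prop. 5.2 and proof (pp. 304–306)] [cite: Jetchev2008, proof of Thm. 1.4 (p. 824)] -/
theorem exists_conductor_levelIndex_ge_of_minDepth_modP (hK : IsImaginaryQuadratic K)
    (hD3 : NumberField.discr K ≠ -3) (hD4 : NumberField.discr K ≠ -4)
    (hH : SatisfiesHeegnerHypothesis (W.conductorNorm ℤ) K) (hcm : ¬ W.HasCM) (hp2 : p ≠ 2)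
    (hsurj : W.HasSurjectiveModNGaloisRep p) (hτ1 : τ ≠ 1) (hττ : τ * τ = 1)
    (Dt : ModularParametrizationData W (W.conductorNorm ℤ)) (β : ℤ) (ι : K →+* ℂ)
    [∀ j : ℕ, NumberField (ringClassField K ι j)]
    (h372 : GrossLMS1991.prop37_2_frobeniusCongruence)
    (inv : LocalInvariants K (p ^ 1)) (hperf : inv.IsPerfect) (hvan : inv.SumLocalTermEqZero)
    (hSC : inv.SelmerComplement) (hinv : inv.IsConjCompatible τ)
    (𝒯 : SelmerStructure ((W.baseChange K).torsionGaloisModule ((p ^ 1 : ℕ) : ℤ)))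
    (h𝒯 : ∀ v : HeightOneSpectrum (𝓞 K), 𝒯 (Sum.inr v) =
      ⨅ (ℓ : ℕ) (_ : ℓ.Prime ∧ (ℓ : 𝓞 K) ∈ v.asIdeal),
        ⨅ (w' : HeightOneSpectrum (𝓞 (ringClassField K ι ℓ)))
          (_ : w'.asIdeal.LiesOver v.asIdeal),
          letI := (adicCompletionOfLiesOver K (ringClassField K ι ℓ) v w').toAlgebra
          transverseSubgroup (GaloisRep.toLocal v ((W.baseChange K).torsionGaloisModule ((p ^ 1 : ℕ) : ℤ)))
            (w'.adicCompletion (ringClassField K ι ℓ)))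
    (h𝒯σ : ∀ (c : ℕ), Squarefree c →
      (∀ q ∈ c.primeFactors, Zhang2014.IsKolyvaginPrime (W.conductorNorm ℤ) W K p q) →
      ∀ (v w : HeightOneSpectrum (𝓞 K)) (h : τ • v = w), v ∈ placesDividing K c →
      ∀ x : galoisCohomology (((W.baseChange K).torsionGaloisModule ((p ^ 1 : ℕ) : ℤ)).toLocal
        (Sum.inr v : Place K)) 1,
      x ∈ 𝒯 (Sum.inr v) → conjActPlace W τ ((p ^ 1 : ℕ) : ℤ) h x ∈ 𝒯 (Sum.inr w))
    (h𝒯sd : ∀ (c : ℕ), Squarefree c →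
      (∀ q ∈ c.primeFactors, Zhang2014.IsKolyvaginPrime (W.conductorNorm ℤ) W K p q) →
      ∀ v ∈ placesDividing K c,
      inv.dualTransported 𝒯 (weilDualIntertwining (W.baseChange K) (p ^ 1) e hμ hadd₁ hadd₂ hgal)
        (Sum.inr v) = 𝒯 (Sum.inr v))
    (hloc : ∀ ℓ : ℕ, Zhang2014.IsKolyvaginPrime (W.conductorNorm ℤ) W K p ℓ →
      1 ≤ Zhang2014.kolyvaginIndex W p ℓ →
      ∀ (v : HeightOneSpectrum (𝓞 K)), (ℓ : 𝓞 K) ∈ v.asIdeal → ∀ (hfix : τ • v = v) (s : ℤ),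
      (s = 1 ∨ s = -1) →
      ((W.baseChange K).kummerSelmerStructure ((p ^ 1 : ℕ) : ℤ) (Sum.inr v)).relIndex
        ((conjActPlace W τ ((p ^ 1 : ℕ) : ℤ) hfix - s • AddMonoidHom.id _).ker) = p ^ 1)
    (hdisj : ∀ ℓ : ℕ, Zhang2014.IsKolyvaginPrime (W.conductorNorm ℤ) W K p ℓ →
      ∀ v : HeightOneSpectrum (𝓞 K), (ℓ : 𝓞 K) ∈ v.asIdeal →
      Disjoint ((W.baseChange K).kummerSelmerStructure ((p ^ 1 : ℕ) : ℤ) (Sum.inr v)) (𝒯 (Sum.inr v)))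
    {n' : ℤ} (hcop' : IsCoprime (p : ℤ) n')
    (hGZ : ∀ (m : ℕ), Squarefree m →
      (∀ q ∈ m.primeFactors, Zhang2014.IsKolyvaginPrime (W.conductorNorm ℤ) W K p q) →
      ∀ (dm : KolyvaginHeegnerData Dt β ι m)
      (γ : ringClassField K ι m ≃ₐ[ℚ] ringClassField K ι m), γ ∈ ringClassGal ι m →
      ∀ v : HeightOneSpectrum (𝓞 K), ¬ (W.baseChange K).HasGoodReductionAt v →
        n' • pointsMap (W.baseChange K) (v.adicCompletion K)
            (dm.toGeomPoints (pointGalHom W (ringClassField K ι m) γ dm.y)) ∈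
          E0Receptacle (W.baseChange K) v ∧
        ∀ (ℓ : ℕ), ℓ ∈ m.primeFactors → ∀ (dm' : KolyvaginHeegnerData Dt β ι (m / ℓ))
          (hle : ringClassField K ι (m / ℓ) ≤ ringClassField K ι m),
          n' • pointsMap (W.baseChange K) (v.adicCompletion K)
              (dm.toGeomPoints (pointGalHom W (ringClassField K ι m) γ
                (WeierstrassCurve.Affine.Point.map (W' := W)
                  ((RingClassField.inclusion ι hle).restrictScalars ℚ) dm'.y))) ∈
            E0Receptacle (W.baseChange K) v)
    {u : ℕ}
    (hmin : ∀ (c : ℕ), Squarefree c →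
      (∀ q ∈ c.primeFactors, Zhang2014.IsKolyvaginPrime (W.conductorNorm ℤ) W K p q ∧
        1 + u ≤ Zhang2014.kolyvaginIndex W p q) →
      ∀ dc : KolyvaginHeegnerData Dt β ι c,
      ∃ Q : (W.baseChange (ringClassField K ι c)).toAffine.Point, ((p ^ u : ℕ) : ℤ) • Q = dc.derivedPoint)
    {n₀ : ℕ} (hn₀ : Squarefree n₀)
    (hn₀K : ∀ q ∈ n₀.primeFactors, Zhang2014.IsKolyvaginPrime (W.conductorNorm ℤ) W K p q ∧
      1 + u ≤ Zhang2014.kolyvaginIndex W p q)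
    (d₀ : KolyvaginHeegnerData Dt β ι n₀)
    (hd₀ : ¬ ∃ Q : (W.baseChange (ringClassField K ι n₀)).toAffine.Point,
      ((p ^ (u + 1) : ℕ) : ℤ) • Q = d₀.derivedPoint)
    (m' : ℕ) :
    ∃ (n : ℕ) (d : KolyvaginHeegnerData Dt β ι n), Squarefree n ∧
      (∀ q ∈ n.primeFactors, Zhang2014.IsKolyvaginPrime (W.conductorNorm ℤ) W K p q ∧
        max m' (1 + u) ≤ Zhang2014.kolyvaginIndex W p q) ∧
      ¬ ∃ Q : (W.baseChange (ringClassField K ι n)).toAffine.Point,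
        ((p ^ (u + 1) : ℕ) : ℤ) • Q = d.derivedPoint := by
  have hp : p.Prime := Fact.out
  have hD : NumberField.discr K < -4 := KolyvaginAssembly.discr_lt_neg_four hK ⟨hD3, hD4⟩
  have hCM1 : phi_heegnerPointOfConductor_mem_range_map_ringClassField (W.conductorNorm ℤ) W K :=
    phi_heegnerPointOfConductor_mem_range_map_ringClassField_holds (W.conductorNorm ℤ) W K
  have hCM2 : exists_generator_ringClassGalOver K := exists_generator_ringClassGalOver_holds
  -- the invariant of the walk
  let Good : ℕ → Prop := fun n ↦ Squarefree n ∧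
    (∀ q ∈ n.primeFactors, Zhang2014.IsKolyvaginPrime (W.conductorNorm ℤ) W K p q ∧
      1 + u ≤ Zhang2014.kolyvaginIndex W p q) ∧
    ∃ d : KolyvaginHeegnerData Dt β ι n, ¬ ∃ Q : (W.baseChange (ringClassField K ι n)).toAffine.Point,
      ((p ^ (u + 1) : ℕ) : ℤ) • Q = d.derivedPoint
  set m₁ : ℕ := max m' (1 + u) with hm₁
  have hm₁1 : 1 ≤ m₁ := le_trans (by omega) (le_max_right _ _)
  -- ONE SWAP
  have hstep : ∀ n, Good n → ∀ ℓ₀ ∈ n.primeFactors, Zhang2014.kolyvaginIndex W p ℓ₀ < m₁ →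
      ∃ ℓ' : ℕ, ℓ'.Prime ∧ ℓ' ∉ n.primeFactors ∧ m₁ ≤ Zhang2014.kolyvaginIndex W p ℓ' ∧
        Good (n / ℓ₀ * ℓ') := by
    rintro n ⟨hn, hnK, d, hd⟩ l₀ hl₀ -
    have hn0 : n ≠ 0 := hn.ne_zero
    have hinert : ∀ (m : ℕ), m ∣ n → ∀ q ∈ m.primeFactors, (Ideal.span {(q : 𝓞 K)}).IsPrime :=
      fun m hm q hq ↦ (hnK q (Nat.primeFactors_mono hm hn0 hq)).1.2.2.2.2.1
    -- data at the divisors of `n`, the given `d` at `n`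
    have hne : ∀ m : ℕ, m ∣ n → Nonempty (KolyvaginHeegnerData Dt β ι m) := fun m hm ↦
      nonempty_kolyvaginHeegnerData_of_grossCM hCM1 hCM2 hK hH Dt β ι d.dvd_sq_sub
        (hn.squarefree_of_dvd hm) (hinert m hm)
    let data : (m : ℕ) → m ∣ n → KolyvaginHeegnerData Dt β ι m := fun m hm ↦
      if h : m = n then h ▸ d else (hne m hm).some
    have hdata : data n dvd_rfl = d := by simp [data]
    have hdvd : ∃ Q : (W.baseChange (ringClassField K ι n)).toAffine.Point,
        ((p ^ u : ℕ) : ℤ) • Q = (data n dvd_rfl).derivedPoint := by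
      rw [hdata]; exact hmin n hn hnK d
    have hndvd : ¬ ∃ Q : (W.baseChange (ringClassField K ι n)).toAffine.Point,
        ((p ^ (u + 1) : ℕ) : ℤ) • Q = (data n dvd_rfl).derivedPoint := by
      rw [hdata]; exact hd
    -- the `λ'` half
    obtain ⟨ℓ', v', v₀, t, -, hKol', hjℓ', hℓ'n, hv', hv₀, ht, htv', hxup⟩ :=
      exists_swapPrime W τ p e hμ hadd₁ hadd₂ hgal halt hnondeg hτe hK hD3 hD4 hH hp2
        hsurj hτ1 hττ Dt β ι inv hperf hvan hSC hinv 𝒯 h𝒯σ h𝒯sd hloc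
        (j := m₁ - 1) (by omega) n hn hnK hl₀ data hdvd hndvd
    rw [hdata] at hxup
    have hm₁ℓ' : m₁ ≤ Zhang2014.kolyvaginIndex W p ℓ' := by omega
    have h1u : 1 + u ≤ Zhang2014.kolyvaginIndex W p ℓ' := le_trans (le_max_right _ _) hm₁ℓ'
    -- compatible data and the `λ₀` half
    obtain ⟨d', d'', hσ, hS, hS', hemb, hσ₁, hS₁, hS₁', hemb₁⟩ :=
      exists_compatible_data_triple_of_grossCM hK hD hH p Dt β ι hn (fun q hq ↦ (hnK q hq).1) hl₀
        hKol' hℓ'n d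
    have hres := not_dvd_of_swap_kolyvagin_modP W τ p e hμ hadd₁ hadd₂ hgal halt hnondeg hτe hK hD3 hD4 hH hcm hp2 hsurj
      hτ1 hττ Dt β ι h372 inv hperf hvan hSC hinv 𝒯 h𝒯 h𝒯σ h𝒯sd hloc hdisj hcop' hGZ hmin hn hnK hl₀
      hKol' h1u hℓ'n hv' hv₀ d d' hσ hS hS' hemb hxup t ht htv' d'' hσ₁ hS₁ hS₁' hemb₁
    refine ⟨ℓ', hKol'.1, hℓ'n, hm₁ℓ', squarefree_swap hn hl₀ hKol'.1 hℓ'n, ?_, d'', hres⟩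
    intro q hq
    rw [primeFactors_swap hn hl₀ hKol'.1, Finset.mem_insert, Finset.mem_erase] at hq
    rcases hq with rfl | ⟨-, hq⟩
    · exact ⟨hKol', h1u⟩
    · exact hnK q hq
  -- THE WALK
  obtain ⟨n, ⟨hn, hnK, d, hd⟩, hM⟩ := exists_forall_le_index_of_swapStep (Zhang2014.kolyvaginIndex W p)
    m₁ Good (fun n h ↦ h.1) hstep ⟨hn₀, hn₀K, d₀, hd₀⟩
  exact ⟨n, d, hn, fun q hq ↦ ⟨(hnK q hq).1, hM q hq⟩, hd⟩

end Summit.BirchSwinnertonDyer.Rank1Residual.JET.Swap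

end
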